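import Literature.AlgebraicGeometry.ModuliOfAbelianVarieties.SiegelCMReciprocitySimilitude
import Literature.AlgebraicGeometry.ModuliOfAbelianVarieties.SiegelShimuraSetDissection
import Literature.AlgebraicGeometry.ModuliOfAbelianVarieties.SiegelPrincipalLevelOpen
import Literature.NumberTheory.ComplexMultiplication.ReflexNormIdelesNormRelation
import HarnessLib

/-!
# The reciprocity element is continuous: (62) factors through an open subgroup of the finite idèles

Topic `AlgebraicGeometry/ModuliOfAbelianVarieties`; namespace `Literature.AlgebraicGeometry.ModuliOfAbelianVarieties`.
THEOREMS ONLY (no definition, no named fact, no instance, no `sorry`).  Cell hodgecm-mathlib, road #60 (`SiegelS1`),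
leaf R60-39 «the reciprocity element is CONTINUOUS / (62) factors through a finite idèle-class quotient» — the non-trivial
half of the consistency of the typed reciprocity law ★ `SiegelRationalModel.IsCanonical` ([Deligne1971TravauxShimura] Déf. 3.13,
4.18–4.21; [Milne2005ShimuraVarieties] Def. 12.8 (60)–(62)) with the Artin map: its right-hand side `[J, r(s)·aK_δ(N)]` is a
LOCALLY CONSTANT function of the finite idèle `s` of `E`, invariant under an OPEN SUBGROUP `U_{a,N}` (this file) and under
`E^×` (★ R60-26 `SiegelShimuraSet.mk_cmRecip_unitEmbedding_mul`), as `σ = art_E(s)` is.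

* §1 The coordinates `adeleCoord i · k : 𝔸_{Kᵢ,f} → 𝔸_{ℚ,f}` of ★ (σ4)-D are `𝔸_{ℚ,f}`-LINEAR for the base-change algebra
  structure `𝔸_{ℚ,f} → 𝔸_{Kᵢ,f}` (the FLT packet's scoped `NumberField.AdeleRing` instances) and hence CONTINUOUS: `𝔸_{Kᵢ,f}`
  carries the `𝔸_{ℚ,f}`-module topology (★ `IsModuleTopology 𝔸ᶠ[ℚ] 𝔸ᶠ[Kᵢ]`, [FLTProject2025]) and linear maps out of a
  module-topology module are continuous (Mathlib `IsModuleTopology.continuous_of_linearMap`).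
* §2 `t ↦ c.cmRepMatrix t` is continuous on `∏ᵢ 𝔸_{Kᵢ,f}` and `s ↦ c.cmRecipMatrix Φ E s` is continuous on `𝔸_{E,f}^×`
  (★ `continuous_reflexNormFiniteIdele`: [MilneCM2006] I Rem. 1.25 «a continuous homomorphism on the groups of idèles»).
* §3 For every `a ∈ GSp_δ(𝔸_f)` and `N ≥ 1` the set `U_{a,N} := {u | r(u) ∈ a·K_δ(N)·a⁻¹}` (spelt with the binder shape of
  `IsCanonical`: `∃ k ∈ K_δ(N), (a k a⁻¹ : matrix) = c.cmRecipMatrix Φ E u`) contains `1`, is closed under `·` and `⁻¹`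
  (★ R60-1b `cmRecipMatrix_mul`), and is OPEN (★ `isOpen_setOf_isCongOne`) — an open subgroup of `𝔸_{E,f}^×`.
* §4 HEAD: for `u ∈ U_{a,N}`, `[J, r(s·u)·aK_δ(N)] = [J, r(s)·aK_δ(N)]` (★ R60-13 `SiegelShimuraSet.mk_mul_of_mem`); together
  with ★ R60-26 the right side of (62) at level `K_δ(N)` and point `[J, a]` is a function on `E^×∖𝔸_{E,f}^×/U_{a,N}`, a
  FINITE idèle-class quotient — exactly the shape through which `s ↦ art_E(s)|` (restricted to a finite abelian layer)
  factors ([Deligne1971TravauxShimura] 3.9–3.10: the reciprocity morphism of a torus is continuous and kills `E^×`).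

## References
* [Deligne1971TravauxShimura] P. Deligne, *Travaux de Shimura* (1971), 3.9–3.10 p. 140, Déf. 3.13 p. 141, 4.18 p. 150.
* [Milne2005ShimuraVarieties] J. S. Milne, *Introduction to Shimura varieties* (2005), §5 (5.1) p. 56, Def. 12.8 (60)–(62) p. 114.
* [MilneCM2006] J. S. Milne, *Complex Multiplication* (2006), Ch. I §1 Rem. 1.25.
* [FLTProject2025] K. Buzzard et al., FLT, `FLT/DedekindDomain/FiniteAdeleRing/BaseChange.lean` (module topology of `𝔸_L^∞`
  over `𝔸_K^∞`).
* [CasselsFrohlichANT1967] Cassels–Fröhlich, Ch. II §14 Lemma (14.2).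
-/

set_option autoImplicit false

noncomputable section

open Matrix NumberField IsDedekindDomain Topology
open scoped TensorProduct NumberField.AdeleRing

namespace Literature.AlgebraicGeometry.ModuliOfAbelianVarieties

open Literature.NumberTheory.ComplexMultiplication
  (traceField ratFiniteAdeleTensorEquiv reflexNormFiniteIdele ratFiniteAdeleTensorEquiv_tmul
    continuous_reflexNormFiniteIdele)

namespace CMStructure

variable {g : ℕ} {δ : Fin g → ℕ} {ι : Type} [Fintype ι] [DecidableEq ι] {K : ι → Type} [∀ i, Field (K i)]
  [∀ i, NumberField (K i)] [∀ i, IsCMField (K i)] (c : CMStructure g δ ι K)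

/-! ### §1. The adelic coordinates are `𝔸_{ℚ,f}`-linear, hence continuous -/

omit [Fintype ι] [DecidableEq ι] [∀ i, IsCMField (K i)] in
/-- **`e_{Kᵢ} : 𝔸_{ℚ,f} ⊗_ℚ Kᵢ ≅ 𝔸_{Kᵢ,f}` is `𝔸_{ℚ,f}`-LINEAR** for the base-change algebra structure `𝔸_{ℚ,f} → 𝔸_{Kᵢ,f}`
(scoped instance of the FLT packet: `r • y = mapSemialgHom r · y`). [cite: CasselsFrohlichANT1967, Ch. II §14 Lemma (14.2)] -/
theorem ratFiniteAdeleTensorEquiv_smul (i : ι) (r : finAdeleQ) (z : finAdeleQ ⊗[ℚ] K i) :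
    ratFiniteAdeleTensorEquiv (K i) (r • z) = r • ratFiniteAdeleTensorEquiv (K i) z := by
  induction z using TensorProduct.induction_on with
  | zero => rw [smul_zero, map_zero, smul_zero]
  | tmul r' a =>
      rw [TensorProduct.smul_tmul', smul_eq_mul, ratFiniteAdeleTensorEquiv_tmul, ratFiniteAdeleTensorEquiv_tmul,
        Algebra.smul_def, map_mul]
      change _ = FiniteAdeleRing.mapSemialgHom (𝓞 ℚ) ℚ (K i) (𝓞 (K i)) r * _
      ring
  | add x y hx hy => rw [smul_add, map_add, hx, hy, map_add, smul_add]

omit [Fintype ι] [DecidableEq ι] [∀ i, IsCMField (K i)] in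
/-- `e_{Kᵢ}⁻¹` is `𝔸_{ℚ,f}`-linear. [cite: CasselsFrohlichANT1967, Ch. II §14 Lemma (14.2)] -/
theorem ratFiniteAdeleTensorEquiv_symm_smul (i : ι) (r : finAdeleQ) (y : FiniteAdeleRing (𝓞 (K i)) (K i)) :
    (ratFiniteAdeleTensorEquiv (K i)).symm (r • y) = r • (ratFiniteAdeleTensorEquiv (K i)).symm y := by
  apply (ratFiniteAdeleTensorEquiv (K i)).injective
  rw [RingEquiv.apply_symm_apply, ratFiniteAdeleTensorEquiv_smul, RingEquiv.apply_symm_apply]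

omit [Fintype ι] [DecidableEq ι] [∀ i, IsCMField (K i)] in
/-- `adeleCoord` is additive. [cite: CasselsFrohlichANT1967, Ch. II §14 Lemma (14.2)] -/
theorem adeleCoord_add (i : ι) (y y' : FiniteAdeleRing (𝓞 (K i)) (K i)) (k : Module.Free.ChooseBasisIndex ℚ (K i)) :
    adeleCoord (K := K) i (y + y') k = adeleCoord (K := K) i y k + adeleCoord (K := K) i y' k := by
  unfold adeleCoord
  rw [map_add, map_add, Finsupp.add_apply]

omit [Fintype ι] [DecidableEq ι] [∀ i, IsCMField (K i)] in
/-- `adeleCoord` is `𝔸_{ℚ,f}`-homogeneous. [cite: CasselsFrohlichANT1967, Ch. II §14 Lemma (14.2)] -/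
theorem adeleCoord_smul (i : ι) (r : finAdeleQ) (y : FiniteAdeleRing (𝓞 (K i)) (K i))
    (k : Module.Free.ChooseBasisIndex ℚ (K i)) :
    adeleCoord (K := K) i (r • y) k = r * adeleCoord (K := K) i y k := by
  unfold adeleCoord
  rw [ratFiniteAdeleTensorEquiv_symm_smul, map_smul, Finsupp.smul_apply, smul_eq_mul]

omit [Fintype ι] [DecidableEq ι] [∀ i, IsCMField (K i)] in
/-- **The adelic coordinates `𝔸_{Kᵢ,f} → 𝔸_{ℚ,f}` are CONTINUOUS**: they are `𝔸_{ℚ,f}`-linear and `𝔸_{Kᵢ,f}` carries the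
`𝔸_{ℚ,f}`-module topology. [cite: FLTProject2025, FLT/DedekindDomain/FiniteAdeleRing/BaseChange.lean (IsModuleTopology)]
[cite: CasselsFrohlichANT1967, Ch. II §14 Lemma (14.2)] -/
theorem continuous_adeleCoord (i : ι) (k : Module.Free.ChooseBasisIndex ℚ (K i)) :
    Continuous fun y : FiniteAdeleRing (𝓞 (K i)) (K i) => adeleCoord (K := K) i y k := by
  let L : FiniteAdeleRing (𝓞 (K i)) (K i) →ₗ[finAdeleQ] finAdeleQ :=
    { toFun := fun y => adeleCoord (K := K) i y k
      map_add' := fun y y' => adeleCoord_add i y y' k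
      map_smul' := fun r y => adeleCoord_smul i r y k }
  exact IsModuleTopology.continuous_of_linearMap L

/-! ### §2. `cmRepMatrix` and `cmRecipMatrix` are continuous -/

/-- **`t ↦ R(t) = c.cmRepMatrix t` is continuous** on `∏ᵢ 𝔸_{Kᵢ,f}` (a finite sum of continuous coordinates times constant
matrices). [cite: Deligne1971TravauxShimura, 3.9 p. 140] -/
theorem continuous_cmRepMatrix : Continuous fun t : Π i, FiniteAdeleRing (𝓞 (K i)) (K i) => c.cmRepMatrix t := by
  unfold cmRepMatrix
  refine continuous_finsetSum _ fun i _ => continuous_finsetSum _ fun k _ => ?_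
  exact ((continuous_adeleCoord i k).comp (continuous_apply i)).smul continuous_const

variable (Φ : ∀ i, Motives.CMType (K i)) (E : IntermediateField ℚ ℂ) [NumberField ↥E]

/-- **`s ↦ r(s) = c.cmRecipMatrix Φ E s` is continuous** on the finite idèles of `E` (units topology): the reflex norms
are continuous ([MilneCM2006] I Rem. 1.25, ★ `continuous_reflexNormFiniteIdele`) and `R` is continuous.
[cite: MilneCM2006, Ch. I §1 Rem. 1.25] [cite: Deligne1971TravauxShimura, 3.9–3.10 p. 140] -/
theorem continuous_cmRecipMatrix : Continuous fun s : (FiniteAdeleRing (𝓞 ↥E) ↥E)ˣ => c.cmRecipMatrix Φ E s := by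
  unfold cmRecipMatrix
  refine c.continuous_cmRepMatrix.comp (continuous_pi fun i => ?_)
  exact Units.continuous_val.comp (continuous_reflexNormFiniteIdele (K i) (Φ i) E)

/-! ### §3. `U_{a,N} = r⁻¹(a K_δ(N) a⁻¹)` is an open subgroup of `𝔸_{E,f}^×` -/

/-- The inverse matrix of `r(s)` is `r(s⁻¹)`. [cite: Milne2005ShimuraVarieties, Def. 12.8 (60) p. 114] -/
theorem coe_inv_eq_cmRecipMatrix_inv (s : (FiniteAdeleRing (𝓞 ↥E) ↥E)ˣ) (r : gspFinAdelic δ)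
    (hr : ((r : GL (Fin g ⊕ Fin g) finAdeleQ) : Matrix (Fin g ⊕ Fin g) (Fin g ⊕ Fin g) finAdeleQ) =
      c.cmRecipMatrix Φ E s) :
    (((r⁻¹ : gspFinAdelic δ) : GL (Fin g ⊕ Fin g) finAdeleQ) : Matrix (Fin g ⊕ Fin g) (Fin g ⊕ Fin g) finAdeleQ) =
      c.cmRecipMatrix Φ E s⁻¹ := by
  have h : ((r : GL (Fin g ⊕ Fin g) finAdeleQ) : Matrix (Fin g ⊕ Fin g) (Fin g ⊕ Fin g) finAdeleQ) *
      c.cmRecipMatrix Φ E s⁻¹ = 1 := by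
    rw [hr, c.cmRecipMatrix_mul_cmRecipMatrix_inv]
  rw [Subgroup.coe_inv]
  exact Units.inv_eq_of_mul_eq_one_right h

/-- **Characterisation of `U_{a,N}` by congruences**: `∃ k ∈ K_δ(N), a k a⁻¹ = r(u)` iff `a⁻¹ r(u) a ≡ 1` and
`a⁻¹ r(u⁻¹) a ≡ 1 (mod N)` as matrices (★ R60-1 `exists_gspFinAdelic_coe_eq_cmRecipMatrix'` supplies `r(u) ∈ GSp_δ(𝔸_f)`).
[cite: Deligne1971TravauxShimura, Exemple 4.16 p. 150 («K(N) = {g | g ≡ 1 mod N}»)] -/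
theorem exists_mem_principalLevelSubgroup_conj_eq_iff {N : ℕ} (hE : ∀ i, traceField (Φ i) ≤ E) (a : gspFinAdelic δ)
    (u : (FiniteAdeleRing (𝓞 ↥E) ↥E)ˣ) :
    (∃ k ∈ principalLevelSubgroup δ N,
        (((a * k * a⁻¹ : gspFinAdelic δ) : GL (Fin g ⊕ Fin g) finAdeleQ) :
          Matrix (Fin g ⊕ Fin g) (Fin g ⊕ Fin g) finAdeleQ) = c.cmRecipMatrix Φ E u) ↔
      IsCongOne N ((((a⁻¹ : gspFinAdelic δ) : GL (Fin g ⊕ Fin g) finAdeleQ) : Matrix (Fin g ⊕ Fin g) (Fin g ⊕ Fin g) finAdeleQ) *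
          c.cmRecipMatrix Φ E u * ((a : GL (Fin g ⊕ Fin g) finAdeleQ) : Matrix (Fin g ⊕ Fin g) (Fin g ⊕ Fin g) finAdeleQ)) ∧
        IsCongOne N ((((a⁻¹ : gspFinAdelic δ) : GL (Fin g ⊕ Fin g) finAdeleQ) : Matrix (Fin g ⊕ Fin g) (Fin g ⊕ Fin g) finAdeleQ) *
          c.cmRecipMatrix Φ E u⁻¹ * ((a : GL (Fin g ⊕ Fin g) finAdeleQ) : Matrix (Fin g ⊕ Fin g) (Fin g ⊕ Fin g) finAdeleQ)) := by
  have hmat : ∀ k : gspFinAdelic δ,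
      (((a⁻¹ * k * a : gspFinAdelic δ) : GL (Fin g ⊕ Fin g) finAdeleQ) : Matrix (Fin g ⊕ Fin g) (Fin g ⊕ Fin g) finAdeleQ) =
        (((a⁻¹ : gspFinAdelic δ) : GL (Fin g ⊕ Fin g) finAdeleQ) : Matrix (Fin g ⊕ Fin g) (Fin g ⊕ Fin g) finAdeleQ) *
          ((k : GL (Fin g ⊕ Fin g) finAdeleQ) : Matrix (Fin g ⊕ Fin g) (Fin g ⊕ Fin g) finAdeleQ) *
            ((a : GL (Fin g ⊕ Fin g) finAdeleQ) : Matrix (Fin g ⊕ Fin g) (Fin g ⊕ Fin g) finAdeleQ) := fun k => by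
    rw [Subgroup.coe_mul, Subgroup.coe_mul, Units.val_mul, Units.val_mul]
  constructor
  · rintro ⟨k, hk, hak⟩
    have hk' : a⁻¹ * (a * k * a⁻¹) * a = k := by group
    have hkinv' : a⁻¹ * (a * k * a⁻¹)⁻¹ * a = k⁻¹ := by group
    rw [mem_principalLevelSubgroup_iff] at hk
    refine ⟨?_, ?_⟩
    · rw [← hak, ← hmat, hk']
      exact hk.1
    · rw [← c.coe_inv_eq_cmRecipMatrix_inv Φ E u _ hak, ← hmat, hkinv', Subgroup.coe_inv]
      exact hk.2
  · rintro ⟨h1, h2⟩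
    obtain ⟨r, hr⟩ := c.exists_gspFinAdelic_coe_eq_cmRecipMatrix' Φ E hE u
    refine ⟨a⁻¹ * r * a, ?_, ?_⟩
    · rw [mem_principalLevelSubgroup_iff]
      refine ⟨?_, ?_⟩
      · rw [hmat, hr]; exact h1
      · have hinv : (a⁻¹ * r * a)⁻¹ = a⁻¹ * r⁻¹ * a := by group
        rw [← Subgroup.coe_inv, hinv, hmat, c.coe_inv_eq_cmRecipMatrix_inv Φ E u r hr]
        exact h2
    · have h : a * (a⁻¹ * r * a) * a⁻¹ = r := by group
      rw [h, hr]

/-- **`U_{a,N}` is OPEN.** [cite: Deligne1971TravauxShimura, 3.9–3.10 p. 140 («morphisme de réciprocité» of a torus, continuous)]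
[cite: MilneCM2006, Ch. I §1 Rem. 1.25] -/
theorem isOpen_setOf_exists_mem_principalLevelSubgroup_conj_eq {N : ℕ} (hN : N ≠ 0) (hE : ∀ i, traceField (Φ i) ≤ E)
    (a : gspFinAdelic δ) :
    IsOpen {u : (FiniteAdeleRing (𝓞 ↥E) ↥E)ˣ | ∃ k ∈ principalLevelSubgroup δ N,
      (((a * k * a⁻¹ : gspFinAdelic δ) : GL (Fin g ⊕ Fin g) finAdeleQ) :
        Matrix (Fin g ⊕ Fin g) (Fin g ⊕ Fin g) finAdeleQ) = c.cmRecipMatrix Φ E u} := by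
  have hset : {u : (FiniteAdeleRing (𝓞 ↥E) ↥E)ˣ | ∃ k ∈ principalLevelSubgroup δ N,
      (((a * k * a⁻¹ : gspFinAdelic δ) : GL (Fin g ⊕ Fin g) finAdeleQ) :
        Matrix (Fin g ⊕ Fin g) (Fin g ⊕ Fin g) finAdeleQ) = c.cmRecipMatrix Φ E u} =
      (fun u => (((a⁻¹ : gspFinAdelic δ) : GL (Fin g ⊕ Fin g) finAdeleQ) : Matrix (Fin g ⊕ Fin g) (Fin g ⊕ Fin g) finAdeleQ) *
          c.cmRecipMatrix Φ E u * ((a : GL (Fin g ⊕ Fin g) finAdeleQ) : Matrix (Fin g ⊕ Fin g) (Fin g ⊕ Fin g) finAdeleQ)) ⁻¹'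
        {A : Matrix (Fin g ⊕ Fin g) (Fin g ⊕ Fin g) finAdeleQ | IsCongOne N A} ∩
      (fun u => (((a⁻¹ : gspFinAdelic δ) : GL (Fin g ⊕ Fin g) finAdeleQ) : Matrix (Fin g ⊕ Fin g) (Fin g ⊕ Fin g) finAdeleQ) *
          c.cmRecipMatrix Φ E u⁻¹ * ((a : GL (Fin g ⊕ Fin g) finAdeleQ) : Matrix (Fin g ⊕ Fin g) (Fin g ⊕ Fin g) finAdeleQ)) ⁻¹'
        {A : Matrix (Fin g ⊕ Fin g) (Fin g ⊕ Fin g) finAdeleQ | IsCongOne N A} := by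
    ext u
    exact c.exists_mem_principalLevelSubgroup_conj_eq_iff Φ E hE a u
  rw [hset]
  refine IsOpen.inter ((isOpen_setOf_isCongOne hN).preimage ?_) ((isOpen_setOf_isCongOne hN).preimage ?_)
  · exact (continuous_const.mul (c.continuous_cmRecipMatrix Φ E)).mul continuous_const
  · exact (continuous_const.mul ((c.continuous_cmRecipMatrix Φ E).comp continuous_inv)).mul continuous_const

/-- `1 ∈ U_{a,N}` (`r(1) = 1`, ★ R60-1b). [cite: Milne2005ShimuraVarieties, Def. 12.8 (60) p. 114] -/
theorem one_mem_setOf_exists_mem_principalLevelSubgroup_conj_eq (N : ℕ) (a : gspFinAdelic δ) :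
    (1 : (FiniteAdeleRing (𝓞 ↥E) ↥E)ˣ) ∈ {u : (FiniteAdeleRing (𝓞 ↥E) ↥E)ˣ | ∃ k ∈ principalLevelSubgroup δ N,
      (((a * k * a⁻¹ : gspFinAdelic δ) : GL (Fin g ⊕ Fin g) finAdeleQ) :
        Matrix (Fin g ⊕ Fin g) (Fin g ⊕ Fin g) finAdeleQ) = c.cmRecipMatrix Φ E u} :=
  ⟨1, Subgroup.one_mem _, by rw [mul_one, mul_inv_cancel, Subgroup.coe_one, Units.val_one, c.cmRecipMatrix_one]⟩

/-- **`U_{a,N}` is a neighbourhood of `1` in `𝔸_{E,f}^×`.** [cite: Deligne1971TravauxShimura, 3.9–3.10 p. 140] -/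
theorem setOf_exists_mem_principalLevelSubgroup_conj_eq_mem_nhds {N : ℕ} (hN : N ≠ 0)
    (hE : ∀ i, traceField (Φ i) ≤ E) (a : gspFinAdelic δ) :
    {u : (FiniteAdeleRing (𝓞 ↥E) ↥E)ˣ | ∃ k ∈ principalLevelSubgroup δ N,
      (((a * k * a⁻¹ : gspFinAdelic δ) : GL (Fin g ⊕ Fin g) finAdeleQ) :
        Matrix (Fin g ⊕ Fin g) (Fin g ⊕ Fin g) finAdeleQ) = c.cmRecipMatrix Φ E u} ∈
      𝓝 (1 : (FiniteAdeleRing (𝓞 ↥E) ↥E)ˣ) :=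
  (c.isOpen_setOf_exists_mem_principalLevelSubgroup_conj_eq Φ E hN hE a).mem_nhds
    (c.one_mem_setOf_exists_mem_principalLevelSubgroup_conj_eq Φ E N a)

/-- `U_{a,N}` is closed under multiplication (`r(u u′) = r(u) r(u′)`, ★ R60-1b). [cite: Milne2005ShimuraVarieties, Def. 12.8 (60) p. 114] -/
theorem mul_mem_setOf_exists_mem_principalLevelSubgroup_conj_eq {N : ℕ} (a : gspFinAdelic δ)
    {u u' : (FiniteAdeleRing (𝓞 ↥E) ↥E)ˣ}
    (hu : ∃ k ∈ principalLevelSubgroup δ N,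
      (((a * k * a⁻¹ : gspFinAdelic δ) : GL (Fin g ⊕ Fin g) finAdeleQ) :
        Matrix (Fin g ⊕ Fin g) (Fin g ⊕ Fin g) finAdeleQ) = c.cmRecipMatrix Φ E u)
    (hu' : ∃ k ∈ principalLevelSubgroup δ N,
      (((a * k * a⁻¹ : gspFinAdelic δ) : GL (Fin g ⊕ Fin g) finAdeleQ) :
        Matrix (Fin g ⊕ Fin g) (Fin g ⊕ Fin g) finAdeleQ) = c.cmRecipMatrix Φ E u') :
    ∃ k ∈ principalLevelSubgroup δ N,
      (((a * k * a⁻¹ : gspFinAdelic δ) : GL (Fin g ⊕ Fin g) finAdeleQ) :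
        Matrix (Fin g ⊕ Fin g) (Fin g ⊕ Fin g) finAdeleQ) = c.cmRecipMatrix Φ E (u * u') := by
  obtain ⟨k, hk, hak⟩ := hu
  obtain ⟨k', hk', hak'⟩ := hu'
  refine ⟨k * k', Subgroup.mul_mem _ hk hk', ?_⟩
  have h : a * (k * k') * a⁻¹ = (a * k * a⁻¹) * (a * k' * a⁻¹) := by group
  rw [h, Subgroup.coe_mul, Units.val_mul, hak, hak', c.cmRecipMatrix_mul]

/-- `U_{a,N}` is closed under inversion. [cite: Milne2005ShimuraVarieties, Def. 12.8 (60) p. 114] -/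
theorem inv_mem_setOf_exists_mem_principalLevelSubgroup_conj_eq {N : ℕ} (a : gspFinAdelic δ)
    {u : (FiniteAdeleRing (𝓞 ↥E) ↥E)ˣ}
    (hu : ∃ k ∈ principalLevelSubgroup δ N,
      (((a * k * a⁻¹ : gspFinAdelic δ) : GL (Fin g ⊕ Fin g) finAdeleQ) :
        Matrix (Fin g ⊕ Fin g) (Fin g ⊕ Fin g) finAdeleQ) = c.cmRecipMatrix Φ E u) :
    ∃ k ∈ principalLevelSubgroup δ N,
      (((a * k * a⁻¹ : gspFinAdelic δ) : GL (Fin g ⊕ Fin g) finAdeleQ) :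
        Matrix (Fin g ⊕ Fin g) (Fin g ⊕ Fin g) finAdeleQ) = c.cmRecipMatrix Φ E u⁻¹ := by
  obtain ⟨k, hk, hak⟩ := hu
  refine ⟨k⁻¹, Subgroup.inv_mem _ hk, ?_⟩
  have h : a * k⁻¹ * a⁻¹ = (a * k * a⁻¹)⁻¹ := by group
  rw [h]
  exact c.coe_inv_eq_cmRecipMatrix_inv Φ E u _ hak

/-! ### §4. HEAD: the right-hand side of (62) is constant on `s · U_{a,N}` -/

/-- **HEAD — (62) factors through an open subgroup of the finite idèles.**  At the principal level `K_δ(N)` and the point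
`[J, a]`: if `u ∈ U_{a,N}` (i.e. `r(u) = a k a⁻¹` for some `k ∈ K_δ(N)`), then for the reciprocity elements `r_s`, `r_{su}`
of `s` and `s·u` (the binder shape of ★ `IsCanonical`): `[J, r_{su}·aK_δ(N)] = [J, r_s·aK_δ(N)]` — since
`r_{su}·a = r_s·a·k`.  With ★ R60-26 (invariance under `E^×`) the right side of (62) is a function on the finite quotient
`E^×∖𝔸_{E,f}^×/U_{a,N}`, as `σ = art_E(s)` restricted to a finite abelian layer is.
[cite: Deligne1971TravauxShimura, 3.9–3.10 p. 140, Déf. 3.13 p. 141, 4.18 p. 150] [cite: Milne2005ShimuraVarieties, Def. 12.8 (62) p. 114] -/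
theorem SiegelShimuraSet.mk_cmRecip_mul_mul_eq {N : ℕ} (a : gspFinAdelic δ) {s u : (FiniteAdeleRing (𝓞 ↥E) ↥E)ˣ}
    (hu : ∃ k ∈ principalLevelSubgroup δ N,
      (((a * k * a⁻¹ : gspFinAdelic δ) : GL (Fin g ⊕ Fin g) finAdeleQ) :
        Matrix (Fin g ⊕ Fin g) (Fin g ⊕ Fin g) finAdeleQ) = c.cmRecipMatrix Φ E u)
    (rs rsu : gspFinAdelic δ)
    (hrs : ((rs : GL (Fin g ⊕ Fin g) finAdeleQ) : Matrix (Fin g ⊕ Fin g) (Fin g ⊕ Fin g) finAdeleQ) =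
      c.cmRecipMatrix Φ E s)
    (hrsu : ((rsu : GL (Fin g ⊕ Fin g) finAdeleQ) : Matrix (Fin g ⊕ Fin g) (Fin g ⊕ Fin g) finAdeleQ) =
      c.cmRecipMatrix Φ E (s * u)) (J : C0pm δ) :
    SiegelShimuraSet.mk δ (principalLevelSubgroup δ N) J (rsu * a) =
      SiegelShimuraSet.mk δ (principalLevelSubgroup δ N) J (rs * a) := by
  obtain ⟨k, hk, hak⟩ := hu
  have heq : rsu = rs * (a * k * a⁻¹) := by
    apply Subtype.ext
    apply Units.ext
    rw [hrsu, c.cmRecipMatrix_mul, Subgroup.coe_mul, Units.val_mul, hrs, hak]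
  have h2 : rsu * a = rs * a * k := by rw [heq]; group
  rw [h2]
  exact SiegelShimuraSet.mk_mul_of_mem δ (principalLevelSubgroup δ N) J (rs * a) hk

/-- **The same for ANY model `R` over `ℚ`, in the currency of ★ `SiegelRationalModel.IsCanonical`**: the right-hand side
`R.ptQ L [J, r(s)·a]` of (62) at `L = K_δ(N)` is unchanged under `s ↦ s·u`, `u ∈ U_{a,N}`.
[cite: Deligne1971TravauxShimura, Déf. 3.13 p. 141] [cite: Milne2005ShimuraVarieties, Def. 12.8 (62) p. 114] -/
theorem SiegelRationalModel.ptQ_mk_cmRecip_mul_mul_eq {Sg : SiegelComplexRecordSystem g δ}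
    (R : SiegelRationalModel g δ Sg) {N : ℕ} (hN : 3 ≤ N) (a : gspFinAdelic δ)
    {s u : (FiniteAdeleRing (𝓞 ↥E) ↥E)ˣ}
    (hu : ∃ k ∈ principalLevelSubgroup δ N,
      (((a * k * a⁻¹ : gspFinAdelic δ) : GL (Fin g ⊕ Fin g) finAdeleQ) :
        Matrix (Fin g ⊕ Fin g) (Fin g ⊕ Fin g) finAdeleQ) = c.cmRecipMatrix Φ E u)
    (rs rsu : gspFinAdelic δ)
    (hrs : ((rs : GL (Fin g ⊕ Fin g) finAdeleQ) : Matrix (Fin g ⊕ Fin g) (Fin g ⊕ Fin g) finAdeleQ) =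
      c.cmRecipMatrix Φ E s)
    (hrsu : ((rsu : GL (Fin g ⊕ Fin g) finAdeleQ) : Matrix (Fin g ⊕ Fin g) (Fin g ⊕ Fin g) finAdeleQ) =
      c.cmRecipMatrix Φ E (s * u)) (J : C0pm δ) :
    R.ptQ (SiegelLevel.ofNat δ N hN) ((Sg.pts (SiegelLevel.ofNat δ N hN)).symm
        (SiegelShimuraSet.mk δ (SiegelLevel.ofNat δ N hN).1 J (rsu * a))) =
      R.ptQ (SiegelLevel.ofNat δ N hN) ((Sg.pts (SiegelLevel.ofNat δ N hN)).symm
        (SiegelShimuraSet.mk δ (SiegelLevel.ofNat δ N hN).1 J (rs * a))) := by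
  have h := SiegelShimuraSet.mk_cmRecip_mul_mul_eq c Φ E a hu rs rsu hrs hrsu J
  exact congrArg (fun P => R.ptQ (SiegelLevel.ofNat δ N hN) ((Sg.pts (SiegelLevel.ofNat δ N hN)).symm P)) h

end CMStructure

end Literature.AlgebraicGeometry.ModuliOfAbelianVarieties

end
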